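import Summits.NavierStokesRegularity.NavierStokesRegularity.Theses.ClockStretchingLaw
import HarnessLib

/-!
# Birth skeleton (BC3) — crux `ClockStretchingLaw.ClockCeiling` (stmt-NavierStokesRegularity-10570)

Route `route-NavierStokesRegularity-ClockStretchingLaw`, crux #2 `ClockCeiling` (the bet of card
clock-mode-stretching-law): along every element `u` of the route's Type-I class (smooth, divergence-free,
KNSS-mild ancient solution on `ℝ³ × (-∞,0)` with `|u| ≤ C/√(-t)` and scale-invariant local energies `A, E ≤ C`)
the CLOCK AMPLITUDE `a_u(t) = (-t)^{3/2} ∫ |∂ₜu(x,t)|² e^{-|x|²/(4(-t))} dx` (`= ‖W(s)‖²_{L²_ρ}`, the size of the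
time-translation Jacobi field in Leray gauge) is not bounded below on `[-1,0)`.

This file is the route-level BIRTH CERTIFICATE skeleton of the crux (LENSES-v3 §2 BC3; registrar seat
`planner-skel-stmt-NavierStokesRegularity-10570-0`, 2026-08-17). It types the route header's own foreseen
layer-2 split (i) of `ClockCeiling` — the FOUR-FRAME DICHOTOMY ("ClockCeiling ⇐ FourFrameCeiling → FourFrameLaw →
ClockCeiling": TWO-LAYER PLAN of the route file) — as two NAMED PIECES, a sorry-free composition, and the skeleton
theorem `ClockCeiling_of : ClockCeiling` (the crux BY NAME), with `sorry` occurring ONLY inside the two stubs.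

## The frame form

Every space-time symmetry of Navier–Stokes is an exact solution of the linearised Leray-gauge equation with a
pinned rate (card: clock 1, translations ½). In PHYSICAL variables and in the normalisation of the crux, the four
symmetry modes at time `t < 0` are the clock mode `√(-t)·√(-t) ∂ₜu(·,t)` and the three translation modes
`∂_b u(·,t) = fderiv ℝ (u t) · b`, `b ∈ ℝ³`, measured in `L²(e^{-|x|²/(4(-t))} dx)` with the common weight
`√(-t)`:

  `frame_u(t; c₀, b) := √(-t) ∫ ‖(c₀ √(-t)) • ∂ₜu(x,t) + ∂_b u(x,t)‖² e^{-|x|²/(4(-t))} dx`,  `c₀² + |b|² = 1`,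

the bottom of the spectrum of the 4 × 4 Gram matrix of the normalised modes (scale-invariant entrywise under
`u ↦ λu(λx,λ²t)`, like `a_u`; `(c₀, b) = (1, 0)` returns `a_u(t)` since `√(-t)·(-t) = (-t)^{3/2}`).

## Pieces

* `stub_frameRigidity` (FRAME RIGIDITY UNDER A CLOCK FLOOR — the rigidity half, plausibly a THEOREM, size L–XL).
  If an element of the class keeps its clock amplitude above `δ > 0` on `[-1,0)`, then its four normalised
  symmetry modes stay UNIFORMLY linearly independent there: `frame_u(t; c₀, b) ≥ η > 0` for all `t ∈ [-1,0)` and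
  all unit `(c₀, b)`. Why plausibly true (known ingredients, no persistence of singularities needed — the clock
  floor itself makes every blow-up limit nontrivial): along a degenerating sequence `(tₙ, c₀ⁿ, bⁿ)` either
  `tₙ → t* ∈ [-1,0)` (continuity of the modes in `L²_ρ`) or `tₙ ↑ 0` (rescale by `λₙ = √(-tₙ)`: the class, the
  floor on `[-1,0)` and the frame form are scale-invariant; KNSS smoothing gives `C^∞_loc` compactness and
  Gaussian-tail domination — KNSS2009 Prop. 4.1, in tree as
  `Literature.Analysis.FluidPDE.knss2009_smoothing_holds`), producing an element `ū` of the class with `a_ū ≥ δ` and an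
  EXACTLY degenerate frame at one instant `t*`: `c₀√(-t*) ∂ₜū + ∂_b ū ≡ 0`. If `c₀ ≠ 0` this is a steady slice of
  the Galilean boost `ū(x + v(t - t*), t) - v`, `v = b/(c₀√(-t*))` — equivalently, without boosting,
  `∂ₜᵏū(t*) = (-v·∇)ᵏū(t*)` for every `k` by translation covariance of the Navier–Stokes operator —, so joint real
  analyticity of bounded Oseen-mild solutions (DongZhang2020 Thm 2 / Lemarié-Rieusset Thm 9.12; in tree:
  `Theorems.analyticOnNhd_uncurry_of_oseenMild`, the engine of the landed `SteadySliceLiouville`) identifies `ū`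
  with the bounded travelling wave `ū(x - v(t - t*), t*)` for all `t < 0`, and the Type-I decay
  `sup|ū(t)| ≤ C/√(-t) → 0` (`t → -∞`) of a travelling wave forces `ū ≡ 0`; if `c₀ = 0` then `|b| = 1` and `ū(t*)` is
  invariant along `b`, the derivative `∂_b ū` solves the linearised equation with zero data at `t*`, vanishes by
  time analyticity (all its time derivatives vanish at `t*`) — so `ū` is a bounded ancient 2½-D mild solution,
  constant by the planar Liouville theorem (KNSS2009 Thm 5.1 for the horizontal part — in tree as
  `Literature.Analysis.FluidPDE.KNSS2009_liouville_planar_holds` —, the ancient heat Liouville theorem for the third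
  component) and zero by Type-I decay plus the zero-mean Oseen identity (as in the landed `SmallStrainRung` proof). Either way `a_ū(t*) = 0 < δ`: contradiction. It is
  COMPLEMENTARY to `ClockLaw` (which is the pure-clock direction `(c₀,b) = (1,0)` on singular models): the floor
  hypothesis removes exactly that direction. Sources: KNSS2009 (arXiv:0709.3599) §4–5, DongZhang2020
  (arXiv:1907.01687) Thm 2, AlbrittonBarker2019 (arXiv:1811.00502) §2, SereginSverak2009.
* `stub_frameCeiling` (FOUR-FRAME CEILING — the OPEN CONTENT, the card's "weaker bet inf Gram₄ = 0").
  Along every element of the class the frame form is not bounded below on `[-1,0)`: for every `η > 0` some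
  `t ∈ [-1,0)` and some unit `(c₀, b)` have `frame_u(t; c₀, b) < η`. It is implied by `ClockCeiling` (take
  `(c₀,b) = (1,0)`), i.e. it is a WEAKER bet: its negation is a Type-I model that out-stretches its clock AND its
  three translations at once — in Leray gauge a 4-volume spanned by exact linearised solutions of rates
  `1, ½, ½, ½` kept from decaying, a normalised stretching bill of `5/2` on a 4-dimensional subspace (card: "the
  bill is 5 = the parabolic dimension"; Constantin–Foias–Temam trace/volume-element technology improves with the
  dimension of the frame, Temam1997 Ch. V–VI, whereas the clock alone asks for the sharp constant `3/2` on one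
  vector). Why it might fail: exactly as the crux — a nontrivial backward discretely self-similar Type-I profile
  (BradshawTsai2017CPDE Open Problem 5.1, Tsai2018 Conj. 8.8; excluded only for SS by NecasRuzickaSverak1996 /
  Tsai1998 and near SS by ChaeWolf2017 Thm 1.3, PineauVicol2026) has a log-periodic, uniformly non-degenerate
  frame by `stub_frameRigidity`. Size: open problem. Sources: GigaKohn1985, MerleZaag1998, Temam1997,
  BradshawTsai2017CPDE, ChaeWolf2017RemovingDSS, KNSS2009.
* `clockCeiling_of_frame : stub₁-sig → stub₂-sig → (the crux statement, verbatim body)` — the REAL composition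
  (sorry-free, axioms ⊆ {propext, Classical.choice, Quot.sound}): fix `C, u` in the class and `δ > 0`; if no
  `t ∈ [-1,0)` had `a_u(t) < δ`, the floor `a_u ≥ δ` holds on `[-1,0)`, frame rigidity gives `η > 0`, and the
  frame ceiling gives `(t, c₀, b)` below `η` — absurd.
* `ClockCeiling_of : ClockCeiling` — THE skeleton theorem: the crux BY NAME (the route decl
  `Summit.NavierStokesRegularity.NavierStokesRegularity.Theses.ClockStretchingLaw.ClockCeiling`, definitional
  unfolding only) from the two declared stubs through `clockCeiling_of_frame`. It is the only theorem of the file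
  whose conclusion head is the crux (gate `skeleton check` shape: no hypotheses other than registered obligations
  by name — hence the implication content `stub-sigs → crux` lives in `clockCeiling_of_frame`).

Not a piece of this line: the regular-origin half of the crux ("at an origin where `u` is bounded `a_u(t) → 0` is
automatic") — the composition argues by contradiction from the floor and never splits regular/singular; and the
Leray-gauge engine children (`LerayGaugeEnergyIdentity`, `StretchingDeficit`) of TWO-LAYER PLAN (iii), which need
the stretching form `N_U` with linearised pressure as a Lean object (route: NOT DECOMPOSED YET) — they are the
natural children of `stub_frameCeiling`, one layer further down, once that vocabulary is requested.

## Disproof used / dead lines / negatives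

`ledger crux ls stmt-NavierStokesRegularity-10570`: no workfiles at registration (no `Disproof.lean`, no
`_false_without_` theorems, no landed `Theorems/ClockCeiling/Negative/*`, no dead lines). `ledger negatives
--problem NavierStokesRegularity` (4 entries: FiniteTangentModuli 4055 — forced parasitic modes of the linearised
equation around a NON-solution drift, unrelated to the four exact symmetry modes of a class element used here;
PerpetualPump Thesis 1832; CorrectorSolvable 1429; BlowupClayNonuniqueness 0154): no stub is an instance of a
refuted statement. Both stubs keep the crux's full class hypothesis VERBATIM (smooth ∧ div-free ∧ KNSS-mild Oseen
identity written through `UnboundedOperators.heatKernel` ∧ `HasTypeITimeDecay C u` ∧ scaled energies `A, E ≤ C`),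
so every hypothesis a future `ClockCeiling_false_without_<H>` could name is available to both stubs.

## BC3 probes (registrar folder `bc/`, 2026-08-17)

For each stub `X ∈ {stub_frameRigidity, stub_frameCeiling}` (its statement pasted as a closed Prop; import: the
route file only): `example : X → ClockCeiling` and `example : X → NavierStokesRegularity` by
`first | exact? | simpa | aesop` (and with the target unfolded, and each alternative alone) under
`set_option maxHeartbeats 400000` — all 44 examples FAIL: the combined forms hit the deterministic
400 000-heartbeat limit (whnf / simp isDefEq on the 1.5 KB hypothesis); `exact?` (goal form, context form, target
unfolded) "could not close the goal"; `simpa`, `simpa [T]` "Tactic `assumption` failed"; `aesop` times out in simp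
normalisation and, with `enableSimp := false`, "failed to prove the goal after exhaustive search" / "made no
progress" (rc 1 for every probe file; full JSON in the registrar's folder `bc/out_*.json`). No stub is cheaply the crux or the summit: frame rigidity is a conditional lower bound that produces
no instant `t`, frame ceiling bounds SOME unit combination of four modes, not the clock mode.

## References

* Y. Giga, R. V. Kohn, Comm. Pure Appl. Math. 38 (1985) 297–319. [GigaKohn1985]
* F. Merle, H. Zaag, Comm. Pure Appl. Math. 51 (1998) 139–196; Math. Ann. 316 (2000). [MerleZaag1998]
* G. Koch, N. Nadirashvili, G. Seregin, V. Šverák, Acta Math. 203 (2009) 83–105 = arXiv:0709.3599. [KNSS2009]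
* H. Dong, Q. S. Zhang, J. Funct. Anal. 279 (2020) 108563 = arXiv:1907.01687, Thm 2. [DongZhang2020]
* D. Albritton, T. Barker, arXiv:1811.00502, §2–3. [AlbrittonBarker2019]
* R. Temam, *Infinite-Dimensional Dynamical Systems in Mechanics and Physics*, 2nd ed. (1997), Ch. V–VI
  (Constantin–Foias–Temam volume elements and trace formulae). [Temam1997]
* Z. Bradshaw, T.-P. Tsai, Comm. PDE 42 (2017), Open Problem 5.1; T.-P. Tsai, *Lectures on Navier–Stokes
  Equations* (2018) Conj. 8.8. [BradshawTsai2017CPDE, Tsai2018]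
* D. Chae, J. Wolf, arXiv:1610.09767, Thm 1.3. [ChaeWolf2017RemovingDSS]
-/

-- `Summit.<Summit>.<Problem>` is the tree's mandated summit-side namespace (CONVENTIONS §2); single-conjunct
-- summit, the duplicate component is deliberate.
set_option linter.dupNamespace false

noncomputable section

namespace Summit.NavierStokesRegularity.NavierStokesRegularity.Cruxes.ClockCeiling.Birth

open scoped BigOperators Topology InnerProductSpace
open MeasureTheory
open Summit.NavierStokesRegularity.NavierStokesRegularity.Theses.ClockStretchingLaw

/-! ## The two registered stubs -/

/-- **Stub 1 `stub_frameRigidity` — FRAME RIGIDITY UNDER A CLOCK FLOOR.** For an element `u` of the Type-I class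
of the crux (constant `C`) and `δ > 0`: if the clock amplitude `a_u(t) = (-t)^{3/2}∫|∂ₜu|²e^{-|x|²/(4(-t))}dx`
stays `≥ δ` on `[-1,0)`, then the four normalised symmetry modes stay uniformly independent in `L²(ρ_t)`:
`η ≤ √(-t) ∫ ‖(c₀√(-t)) • ∂ₜu + ∂_b u‖² e^{-|x|²/(4(-t))} dx` for all `t ∈ [-1,0)` and all `c₀² + |b|² = 1`, some
`η > 0`. Plausibly TRUE (compactness in the scale-invariant class + two one-instant Liouville alternatives —
Galilean steady slice via time analyticity, and 2½-D slice via the planar Liouville theorem — + Type-I decay; the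
floor replaces persistence of singularities). Size L–XL. Complementary to `ClockLaw` (the floor removes the
pure-clock direction). [KNSS2009, DongZhang2020, AlbrittonBarker2019, SereginSverak2009] -/
theorem stub_frameRigidity :
        ∀ (C : ℝ) (u : ℝ → EuclideanSpace ℝ (Fin 3) → EuclideanSpace ℝ (Fin 3)), ContDiffOn ℝ (⊤ : ℕ∞) (Function.uncurry u) (Set.Iio 0 ×ˢ Set.univ) ∧ (∀ t < 0, Literature.Analysis.FluidPDE.VectorCalculus.IsDivFree (u t)) ∧ (∀ s t : ℝ, s < t → t < 0 → ∀ x, u t x = Literature.Analysis.FluidPDE.heatFlow (u s) (t - s) x - ∫ τ in Set.Ioo s t, ∫ y, ((-(inner ℝ (x - y) (u τ y) / (2 * (t - τ)) * Literature.Analysis.UnboundedOperators.heatKernel (t - τ) (x - y))) • u τ y + (∫ σ in Set.Ioi (t - τ), Literature.Analysis.UnboundedOperators.heatKernel σ (x - y) / (4 * σ ^ 2)) • (inner ℝ (x - y) (u τ y) • u τ y + inner ℝ (u τ y) (u τ y) • (x - y) + inner ℝ (x - y) (u τ y) • u τ y) - ((∫ σ in Set.Ioi (t - τ), Literature.Analysis.UnboundedOperators.heatKernel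 σ (x - y) / (8 * σ ^ 3)) * (inner ℝ (x - y) (u τ y) * inner ℝ (x - y) (u τ y))) • (x - y))) ∧ Literature.Analysis.FluidPDE.HasTypeITimeDecay C u ∧ (∀ (x₀ : EuclideanSpace ℝ (Fin 3)) (t₀ r : ℝ), t₀ ≤ 0 → 0 < r → (∀ t, t₀ - r ^ 2 < t → t < t₀ → r⁻¹ * ∫ x in Metric.ball x₀ r, ‖u t x‖ ^ 2 ≤ C) ∧ r⁻¹ * ∫ t in Set.Ioo (t₀ - r ^ 2) t₀, ∫ x in Metric.ball x₀ r, ‖fderiv ℝ (u t) x‖ ^ 2 ≤ C) → ∀ δ > 0, (∀ t : ℝ, -1 ≤ t → t < 0 → δ ≤ (-t) ^ ((3 : ℝ) / 2) * ∫ x, ‖Literature.Analysis.FluidPDE.timeDeriv u t x‖ ^ 2 * Real.exp (-(‖x‖ ^ 2) / (4 * (-t)))) → ∃ η > 0, ∀ t : ℝ, -1 ≤ t → t < 0 → ∀ (c₀ : ℝ) (b : EuclideanSpace ℝ (Fin 3)), c₀ ^ 2 + ‖b‖ ^ 2 = 1 → η ≤ Real.sqrt (-t) * ∫ x, ‖(c₀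 * Real.sqrt (-t)) • Literature.Analysis.FluidPDE.timeDeriv u t x + fderiv ℝ (u t) x b‖ ^ 2 * Real.exp (-(‖x‖ ^ 2) / (4 * (-t))) := by
  sorry

/-- **Stub 2 `stub_frameCeiling` — FOUR-FRAME CEILING (the open content; the card's weaker bet
"inf Gram₄ = 0").** Along every element of the Type-I class the frame form is not bounded below on `[-1,0)`:
for every `η > 0` some `t ∈ [-1,0)` and some unit `(c₀, b)` have
`√(-t) ∫ ‖(c₀√(-t)) • ∂ₜu + ∂_b u‖² e^{-|x|²/(4(-t))} dx < η`. Implied by `ClockCeiling` (`(c₀,b) = (1,0)`); its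
negation is a Type-I model keeping the 4-volume of its clock and translation modes (Leray-gauge rates
`1, ½, ½, ½`) from decaying — a normalised stretching bill of `5/2` on a 4-dimensional subspace, to be attacked
with Constantin–Foias–Temam trace/volume-element bounds. Why it might fail: a backward DSS Type-I profile
(BradshawTsai2017CPDE OP 5.1) would have a log-periodic non-degenerate frame. Size: open problem.
[GigaKohn1985, MerleZaag1998, Temam1997, BradshawTsai2017CPDE, ChaeWolf2017RemovingDSS, KNSS2009] -/
theorem stub_frameCeiling :
        ∀ (C : ℝ) (u : ℝ → EuclideanSpace ℝ (Fin 3) → EuclideanSpace ℝ (Fin 3)), ContDiffOn ℝ (⊤ : ℕ∞) (Function.uncurry u) (Set.Iio 0 ×ˢ Set.univ) ∧ (∀ t < 0, Literature.Analysis.FluidPDE.VectorCalculus.IsDivFree (u t)) ∧ (∀ s t : ℝ, s < t → t < 0 → ∀ x, u t x = Literature.Analysis.FluidPDE.heatFlow (u s) (t - s) x - ∫ τ in Set.Ioo s t, ∫ y, ((-(inner ℝ (x - y) (u τ y) / (2 * (t - τ)) * Literature.Analysis.UnboundedOperators.heatKernel (t - τ) (x - y))) • u τ y + (∫ σ in Set.Ioi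 (t - τ), Literature.Analysis.UnboundedOperators.heatKernel σ (x - y) / (4 * σ ^ 2)) • (inner ℝ (x - y) (u τ y) • u τ y + inner ℝ (u τ y) (u τ y) • (x - y) + inner ℝ (x - y) (u τ y) • u τ y) - ((∫ σ in Set.Ioi (t - τ), Literature.Analysis.UnboundedOperators.heatKernel σ (x - y) / (8 * σ ^ 3)) * (inner ℝ (x - y) (u τ y) * inner ℝ (x - y) (u τ y))) • (x - y))) ∧ Literature.Analysis.FluidPDE.HasTypeITimeDecay C u ∧ (∀ (x₀ : EuclideanSpace ℝ (Fin 3)) (t₀ r : ℝ), t₀ ≤ 0 → 0 < r → (∀ t, t₀ - r ^ 2 < t → t < t₀ → r⁻¹ * ∫ x in Metric.ball x₀ r, ‖u t x‖ ^ 2 ≤ C) ∧ r⁻¹ * ∫ t in Set.Ioo (t₀ - r ^ 2) t₀, ∫ x in Metric.ball x₀ r, ‖fderiv ℝ (u t) x‖ ^ 2 ≤ C) → ∀ η > 0, ∃ t : ℝ, -1 ≤ t ∧ t < 0 ∧ ∃ (c₀ : ℝ) (b : EuclideanSpace ℝ (Fin 3)), c₀ ^ 2 + ‖b‖ ^ 2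 = 1 ∧ Real.sqrt (-t) * ∫ x, ‖(c₀ * Real.sqrt (-t)) • Literature.Analysis.FluidPDE.timeDeriv u t x + fderiv ℝ (u t) x b‖ ^ 2 * Real.exp (-(‖x‖ ^ 2) / (4 * (-t))) < η := by
  sorry

/-! ## Sorry-free composition -/

/-- **The crux statement from the two pieces** (the implication content of the skeleton; SORRY-FREE, standard
axioms). Hypotheses: the statements of `stub_frameRigidity` and `stub_frameCeiling`, verbatim. Conclusion: the
body of `ClockStretchingLaw.ClockCeiling`, verbatim. Proof: fix `C, u` in the class and `δ > 0`; were there no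
`t ∈ [-1,0)` with `a_u(t) < δ`, the floor `δ ≤ a_u` would hold on `[-1,0)`, frame rigidity would give a uniform
`η > 0`, and the frame ceiling an instant and a unit combination below `η`. [folklore] -/
theorem clockCeiling_of_frame
    (hR : ∀ (C : ℝ) (u : ℝ → EuclideanSpace ℝ (Fin 3) → EuclideanSpace ℝ (Fin 3)), ContDiffOn ℝ (⊤ : ℕ∞) (Function.uncurry u) (Set.Iio 0 ×ˢ Set.univ) ∧ (∀ t < 0, Literature.Analysis.FluidPDE.VectorCalculus.IsDivFree (u t)) ∧ (∀ s t : ℝ, s < t → t < 0 → ∀ x, u t x = Literature.Analysis.FluidPDE.heatFlow (u s) (t - s) x - ∫ τ in Set.Ioo s t, ∫ y, ((-(inner ℝ (x - y) (u τ y) / (2 * (t - τ)) * Literature.Analysis.UnboundedOperators.heatKernel (t - τ) (x - y))) • u τ y + (∫ σ in Set.Ioi (t - τ), Literature.Analysis.UnboundedOperators.heatKernel σ (x - y) / (4 * σ ^ 2)) • (inner ℝ (x - y) (u τ y) • u τ y + inner ℝ (u τ y) (u τ y) • (x - y) + inner ℝ (x - y) (u τ y) • u τ y) - ((∫ σ in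 Set.Ioi (t - τ), Literature.Analysis.UnboundedOperators.heatKernel σ (x - y) / (8 * σ ^ 3)) * (inner ℝ (x - y) (u τ y) * inner ℝ (x - y) (u τ y))) • (x - y))) ∧ Literature.Analysis.FluidPDE.HasTypeITimeDecay C u ∧ (∀ (x₀ : EuclideanSpace ℝ (Fin 3)) (t₀ r : ℝ), t₀ ≤ 0 → 0 < r → (∀ t, t₀ - r ^ 2 < t → t < t₀ → r⁻¹ * ∫ x in Metric.ball x₀ r, ‖u t x‖ ^ 2 ≤ C) ∧ r⁻¹ * ∫ t in Set.Ioo (t₀ - r ^ 2) t₀, ∫ x in Metric.ball x₀ r, ‖fderiv ℝ (u t) x‖ ^ 2 ≤ C) → ∀ δ > 0, (∀ t : ℝ, -1 ≤ t → t < 0 → δ ≤ (-t) ^ ((3 : ℝ) / 2) * ∫ x, ‖Literature.Analysis.FluidPDE.timeDeriv u t x‖ ^ 2 * Real.exp (-(‖x‖ ^ 2) / (4 * (-t)))) → ∃ η > 0, ∀ t : ℝ, -1 ≤ t → t < 0 → ∀ (c₀ : ℝ) (b : EuclideanSpace ℝ (Fin 3)), c₀ ^ 2 + ‖b‖ ^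 2 = 1 → η ≤ Real.sqrt (-t) * ∫ x, ‖(c₀ * Real.sqrt (-t)) • Literature.Analysis.FluidPDE.timeDeriv u t x + fderiv ℝ (u t) x b‖ ^ 2 * Real.exp (-(‖x‖ ^ 2) / (4 * (-t))))
    (hC : ∀ (C : ℝ) (u : ℝ → EuclideanSpace ℝ (Fin 3) → EuclideanSpace ℝ (Fin 3)), ContDiffOn ℝ (⊤ : ℕ∞) (Function.uncurry u) (Set.Iio 0 ×ˢ Set.univ) ∧ (∀ t < 0, Literature.Analysis.FluidPDE.VectorCalculus.IsDivFree (u t)) ∧ (∀ s t : ℝ, s < t → t < 0 → ∀ x, u t x = Literature.Analysis.FluidPDE.heatFlow (u s) (t - s) x - ∫ τ in Set.Ioo s t, ∫ y, ((-(inner ℝ (x - y) (u τ y) / (2 * (t - τ)) * Literature.Analysis.UnboundedOperators.heatKernel (t - τ) (x - y))) • u τ y + (∫ σ in Set.Ioi (t - τ), Literature.Analysis.UnboundedOperators.heatKernel σ (x - y) / (4 * σ ^ 2)) • (inner ℝ (x - y) (u τ y) • u τ y + inner ℝ (u τ y) (u τ y) • (x - y) + inner ℝ (x - y) (u τ y)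 • u τ y) - ((∫ σ in Set.Ioi (t - τ), Literature.Analysis.UnboundedOperators.heatKernel σ (x - y) / (8 * σ ^ 3)) * (inner ℝ (x - y) (u τ y) * inner ℝ (x - y) (u τ y))) • (x - y))) ∧ Literature.Analysis.FluidPDE.HasTypeITimeDecay C u ∧ (∀ (x₀ : EuclideanSpace ℝ (Fin 3)) (t₀ r : ℝ), t₀ ≤ 0 → 0 < r → (∀ t, t₀ - r ^ 2 < t → t < t₀ → r⁻¹ * ∫ x in Metric.ball x₀ r, ‖u t x‖ ^ 2 ≤ C) ∧ r⁻¹ * ∫ t in Set.Ioo (t₀ - r ^ 2) t₀, ∫ x in Metric.ball x₀ r, ‖fderiv ℝ (u t) x‖ ^ 2 ≤ C) → ∀ η > 0, ∃ t : ℝ, -1 ≤ t ∧ t < 0 ∧ ∃ (c₀ : ℝ) (b : EuclideanSpace ℝ (Fin 3)), c₀ ^ 2 + ‖b‖ ^ 2 = 1 ∧ Real.sqrt (-t) * ∫ x, ‖(c₀ * Real.sqrt (-t)) • Literature.Analysis.FluidPDE.timeDeriv u t x + fderiv ℝ (u t) x b‖ ^ 2 * Real.exp (-(‖x‖ ^ 2)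 / (4 * (-t))) < η) :
    ∀ (C : ℝ) (u : ℝ → EuclideanSpace ℝ (Fin 3) → EuclideanSpace ℝ (Fin 3)), ContDiffOn ℝ (⊤ : ℕ∞) (Function.uncurry u) (Set.Iio 0 ×ˢ Set.univ) ∧ (∀ t < 0, Literature.Analysis.FluidPDE.VectorCalculus.IsDivFree (u t)) ∧ (∀ s t : ℝ, s < t → t < 0 → ∀ x, u t x = Literature.Analysis.FluidPDE.heatFlow (u s) (t - s) x - ∫ τ in Set.Ioo s t, ∫ y, ((-(inner ℝ (x - y) (u τ y) / (2 * (t - τ)) * Literature.Analysis.UnboundedOperators.heatKernel (t - τ) (x - y))) • u τ y + (∫ σ in Set.Ioi (t - τ), Literature.Analysis.UnboundedOperators.heatKernel σ (x - y) / (4 * σ ^ 2)) • (inner ℝ (x - y) (u τ y) • u τ y + inner ℝ (u τ y) (u τ y) • (x - y) + inner ℝ (x - y) (u τ y) • u τ y) - ((∫ σ in Set.Ioi (t - τ), Literature.Analysis.UnboundedOperators.heatKernel σ (x - y) / (8 * σ ^ 3)) * (inner ℝ (x - y) (u τ y) * inner ℝ (x - y) (u τ y))) • (x - y))) ∧ Literature.Analysis.FluidPDE.HasTypeITimeDecay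 C u ∧ (∀ (x₀ : EuclideanSpace ℝ (Fin 3)) (t₀ r : ℝ), t₀ ≤ 0 → 0 < r → (∀ t, t₀ - r ^ 2 < t → t < t₀ → r⁻¹ * ∫ x in Metric.ball x₀ r, ‖u t x‖ ^ 2 ≤ C) ∧ r⁻¹ * ∫ t in Set.Ioo (t₀ - r ^ 2) t₀, ∫ x in Metric.ball x₀ r, ‖fderiv ℝ (u t) x‖ ^ 2 ≤ C) → ∀ δ > 0, ∃ t : ℝ, -1 ≤ t ∧ t < 0 ∧ (-t) ^ ((3 : ℝ) / 2) * ∫ x, ‖Literature.Analysis.FluidPDE.timeDeriv u t x‖ ^ 2 * Real.exp (-(‖x‖ ^ 2) / (4 * (-t))) < δ := by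
  intro C u hu δ hδ
  by_contra h
  push Not at h
  obtain ⟨η, hη, hlaw⟩ := hR C u hu δ hδ h
  obtain ⟨t, ht₁, ht₂, c₀, b, hcb, hlt⟩ := hC C u hu η hη
  exact absurd (hlaw t ht₁ ht₂ c₀ b hcb) (not_le.mpr hlt)

/-! ## The skeleton theorem -/

/-- **`ClockCeiling` — the route declaration BY NAME** (item stmt-NavierStokesRegularity-10570), from the two
registered stubs through the sorry-free composition `clockCeiling_of_frame` (definitional unfolding of the route
`def` only). The only `sorry` in its closure is the stubs'. -/
theorem ClockCeiling_of : ClockCeiling :=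
  clockCeiling_of_frame stub_frameRigidity stub_frameCeiling

end Summit.NavierStokesRegularity.NavierStokesRegularity.Cruxes.ClockCeiling.Birth

end
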